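import Literature.AlgebraicGeometry.AbelianSchemes.AbelianSchemeDualIsogenyComp
import Literature.AlgebraicGeometry.AbelianSchemes.AbelianSchemeDualIsogenyHom
import Literature.AlgebraicGeometry.AbelianSchemes.AbelianSchemeQuotientPolarizationIdentity
import Literature.AlgebraicGeometry.GroupSchemes.GroupSchemeKernel
import Literature.AlgebraicGeometry.AbelianSchemes.DualIsogenyBaseChange
import Literature.AlgebraicGeometry.GroupSchemes.GroupSchemeKernelBaseChange
import Mathlib.AlgebraicGeometry.Morphisms.Finite
import Mathlib.AlgebraicGeometry.Morphisms.Flat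
import HarnessLib

/-!
# The dual-position kernel `Ker(ψ^∨) ⊂ B̂` of an isogeny datum `ψ : A′ → B` of abelian schemes
# (Mumford AV §15 Thm. 1; Rapoport–Smithling–Zhang 2020 §4.1 — lattice-chain form of the level at a split place)
Topic `Literature/AlgebraicGeometry/AbelianSchemes`, namespace `Literature.AlgebraicGeometry.AbelianSchemes.AbelianSchemeOver.DualPair`.
THEOREMS ONLY (no definition, no named fact, no instance, no notation; net Literature debt 0).
Cell `hodgecm-mathlib` (D-0151), FLOOR-0 P6 «MOD», letter ST-0′ «DUAL-POSITION KERNEL» (LEAD ruling M-13a (a), 2026-09-01):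
the `w̄`-datum of the moduli HEART is NOT an annihilator under a scheme-level Weil pairing (which would need
Cartier duality `ker ψ^∨ ≅ (ker ψ)^D` of finite flat group schemes) but the KERNEL OF THE DUAL HOMOMORPHISM
`ψ^∨ : B̂ → Â′` of the isogeny datum `ψ : A′ → B` (chain form: the isogeny is the datum, `C := ker ψ` is derived and no
quotient `A′ ⧸ C` is formed).  Everything is stated about ★ `GroupSchemeKernel.ker (dualIsogenyOver ψ D′ DB)`.
## Mathematics
Let `S` be a scheme, `ψ : A′ → B` a homomorphism of abelian `S`-schemes with dual pairs `D′ = (Â′, 𝒫′)`,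
`DB = (B̂, 𝒫_B)` (★ `AbelianSchemeDualPair`), and `ψ^∨ : B̂ → Â′` its dual homomorphism (★ `dualIsogenyOver`).
* §1 `isClosedImmersion_kerι_dualIsogenyOver_left`: **`K := Ker(ψ^∨) ↪ B̂` is a closed immersion** (an abelian scheme
  is separated over `S`, so its unit section is closed, ★ `isClosedImmersion_kerι_left_of_isSeparated`), and
  `kerι_dualIsogenyOver_comp`: `K ↪ B̂ → Â′` is trivial.
* §2 `dualIsogenyOver_comm` / `exists_kerLift_dualIsogenyOver_comm` (**`𝒪`-STABILITY**): if endomorphisms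
  `α` of `A′` and `β` of `B` satisfy `α ≫ ψ = ψ ≫ β`, then `β^∨ ≫ ψ^∨ = ψ^∨ ≫ α^∨` (★ `dualIsogenyOver_comp`), hence
  (for rigidified Poincaré modules, so that `α^∨` preserves the unit, ★ `one_comp_dualIsogenyOver`) `β^∨` maps `K` into
  `K`: `∃ t : K → K, t ≫ ι = ι ≫ β^∨` — applied to the `𝒪_F`-action `ι(a)` on both sides this is the
  `𝒪_F`-stability of the `w̄`-datum.
* §3 (ED. 2) **BASE CHANGE**: `pullback_map_dualIsogenyOver` — `ψ^∨ ×_S S′ = (ψ_{S′})^∨` in `Over S′` (★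
  `dualIsogeny_baseChange_eq_lift`), and `exists_ker_dualIsogenyOver_baseChange_iso` — **`K ×_S S′ ≅ Ker((ψ_{S′})^∨)`**
  compatibly with the inclusions into `B̂ ×_S S′` (★ `GroupSchemeKernel.baseChangeIso`): the dual-position kernel commutes
  with every base change `S′ → S` (the three levels `S ← Spec κ(w) ← Spec k̄` of the HEART).
* §4 (ED. 3) **FINITE FLAT**: `Ker(ψ^∨) → S` is the base change of `ψ^∨ : B̂ → Â′` along the unit section `ε : S → Â′`
  (`snd_left_comp_eq_hom`, ★ `isPullback_kerι_left`), hence FINITE, resp. FLAT, resp. locally of finite presentation, as soon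
  as `ψ^∨` is (`isFinite_ker_dualIsogenyOver_hom`, `flat_ker_dualIsogenyOver_hom`) — the «finite flat closed subgroup scheme»
  clause of the `w̄`-datum for an isogeny `ψ` whose dual is an isogeny.
## References
* [MumfordAV1970] D. Mumford, *Abelian Varieties*, §15 Thm. 1 (p. 143): the dual homomorphism and its kernel.
* [RapoportSmithlingZhang2020Diagonal] M. Rapoport, B. Smithling, W. Zhang, *Arithmetic diagonal cycles on unitary
  Shimura varieties*, Compos. Math. 156 (2020), §4.1 (the moduli problem at a split place in lattice-chain form).
* [GortzWedhorn2020] U. Görtz, T. Wedhorn, *Algebraic Geometry I*, Def. 4.45 (2) (kernels of homomorphisms of group schemes).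
-/

universe u

open CategoryTheory CategoryTheory.Limits AlgebraicGeometry MonoidalCategory CartesianMonoidalCategory

noncomputable section

namespace Literature.AlgebraicGeometry.AbelianSchemes

open scoped MonObj
open Literature.AlgebraicGeometry.GroupSchemes
open Literature.AlgebraicGeometry.GroupSchemes.GroupSchemeKernel

namespace AbelianSchemeOver

namespace DualPair

variable {S : Scheme.{u}} {A' B : AbelianSchemeOver S} (ψ : A'.X ⟶ B.X) [IsMonHom ψ]
  (D' : A'.DualPair) (DB : B.DualPair)

/-! ### §1 `Ker(ψ^∨) ↪ B̂` is a closed subgroup scheme -/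

/-- An abelian scheme is separated over its base (it is proper). [cite: MumfordAV1970, §15 Thm. 1 (p. 143)] -/
theorem isSeparated_hat_hom : IsSeparated D'.hat.X.hom := by
  haveI := D'.hat.isProper
  infer_instance

/-- **`Ker(ψ^∨) ↪ B̂` is a closed immersion**: the kernel of the dual homomorphism `ψ^∨ : B̂ → Â′` is a closed
subscheme of `B̂` (the unit section of the separated `S`-scheme `Â′` is a closed immersion).
[cite: MumfordAV1970, §15 Thm. 1 (p. 143)] [cite: GortzWedhorn2020, Definition 4.45 (2), p. 117] -/
theorem isClosedImmersion_kerι_dualIsogenyOver_left :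
    IsClosedImmersion (kerι (dualIsogenyOver ψ D' DB)).left := by
  haveI := isSeparated_hat_hom D'
  exact isClosedImmersion_kerι_left_of_isSeparated (dualIsogenyOver ψ D' DB)

/-- `Ker(ψ^∨) ↪ B̂ → Â′` is the trivial homomorphism. [cite: GortzWedhorn2020, Definition 4.45 (2), p. 117] -/
theorem kerι_dualIsogenyOver_comp : kerι (dualIsogenyOver ψ D' DB) ≫ dualIsogenyOver ψ D' DB = 1 :=
  kerι_comp _

/-- `Ker(ψ^∨) → S` is the structure morphism of a closed subscheme of `B̂`: `(Ker ψ^∨).hom = ι ≫ (B̂ → S)`.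
[cite: GortzWedhorn2020, Definition 4.45 (2), p. 117] -/
theorem kerι_dualIsogenyOver_left_comp_hom :
    (kerι (dualIsogenyOver ψ D' DB)).left ≫ DB.hat.X.hom = (ker (dualIsogenyOver ψ D' DB)).hom :=
  Over.w _

/-! ### §2 `𝒪`-stability: endomorphisms compatible with `ψ` preserve `Ker(ψ^∨)` -/

section Equivariance

variable (α : A'.X ⟶ A'.X) [IsMonHom α] (β : B.X ⟶ B.X) [IsMonHom β]

/-- **`β^∨ ≫ ψ^∨ = ψ^∨ ≫ α^∨` when `α ≫ ψ = ψ ≫ β`** (duality is a contravariant functor, ★ `dualIsogenyOver_comp`).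
[cite: MumfordAV1970, §15 Thm. 1 (p. 143)] -/
theorem dualIsogenyOver_comm (h : α ≫ ψ = ψ ≫ β) :
    dualIsogenyOver β DB DB ≫ dualIsogenyOver ψ D' DB = dualIsogenyOver ψ D' DB ≫ dualIsogenyOver α D' D' := by
  rw [← dualIsogenyOver_comp ψ β D' DB DB, ← dualIsogenyOver_comp α ψ D' D' DB]
  exact dualIsogenyOver_congr D' DB h.symm

/-- **`Ker(ψ^∨)` IS STABLE UNDER `β^∨`** whenever `α ≫ ψ = ψ ≫ β` for some endomorphism `α` of `A′` (rigidified Poincaré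
modules): there is `t : Ker(ψ^∨) → Ker(ψ^∨)` with `t ≫ ι = ι ≫ β^∨`.  With `α = ι_{A′}(a)`, `β = ι_B(a)` for `a ∈ 𝒪_F`
this is the `𝒪_F`-stability of the dual-position kernel. [cite: MumfordAV1970, §15 Thm. 1 (p. 143)]
[cite: RapoportSmithlingZhang2020Diagonal, §4.1] -/
theorem exists_kerLift_dualIsogenyOver_comm (h : α ≫ ψ = ψ ≫ β)
    (hD' : Nonempty ((Scheme.Modules.pullback (unitHatSlice D')).obj D'.P ≅ SheafOfModules.unit _)) :
    ∃ t : ker (dualIsogenyOver ψ D' DB) ⟶ ker (dualIsogenyOver ψ D' DB),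
      t ≫ kerι (dualIsogenyOver ψ D' DB) = kerι (dualIsogenyOver ψ D' DB) ≫ dualIsogenyOver β DB DB := by
  refine ⟨kerLift (kerι (dualIsogenyOver ψ D' DB) ≫ dualIsogenyOver β DB DB) ?_, kerLift_ι _ _⟩
  rw [Category.assoc, dualIsogenyOver_comm ψ D' DB α β h, ← Category.assoc, kerι_dualIsogenyOver_comp,
    Hom.one_def, Category.assoc, one_comp_dualIsogenyOver α D' D' hD' hD']

/-- The lift of §2 is unique (`ι` is a monomorphism). [cite: GortzWedhorn2020, Definition 4.45 (2), p. 117] -/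
theorem kerLift_dualIsogenyOver_unique
    {t t' : ker (dualIsogenyOver ψ D' DB) ⟶ ker (dualIsogenyOver ψ D' DB)}
    (ht : t ≫ kerι (dualIsogenyOver ψ D' DB) = kerι (dualIsogenyOver ψ D' DB) ≫ dualIsogenyOver β DB DB)
    (ht' : t' ≫ kerι (dualIsogenyOver ψ D' DB) = kerι (dualIsogenyOver ψ D' DB) ≫ dualIsogenyOver β DB DB) :
    t = t' :=
  ker_hom_ext (ht.trans ht'.symm)

end Equivariance

/-! ### §3 (ED. 2) Base change: `Ker(ψ^∨) ×_S S′ ≅ Ker((ψ_{S′})^∨)` -/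

section BaseChange

set_option backward.isDefEq.respectTransparency false

open scoped Obj

variable {S' : Scheme.{u}} (g : S' ⟶ S)

/-- **`ψ^∨ ×_S S′ = (ψ_{S′})^∨` in `Over S′`**: the base change of the dual homomorphism is the dual homomorphism of
the base change, formed with respect to the base-changed dual pairs (★ `dualIsogeny_baseChange_eq_lift`).
[cite: MumfordAV1970, §15 Thm. 1 (p. 143)] -/
theorem pullback_map_dualIsogenyOver :
    (Over.pullback g).map (dualIsogenyOver ψ D' DB) =
      @dualIsogenyOver S' (A'.baseChange g) (B.baseChange g) (baseChangeHom ψ g) (isMonHom_baseChangeHom ψ g)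
        (D'.baseChange g) (DB.baseChange g) := by
  apply Over.OverMorphism.ext
  simp only [Over.pullback_map_left, dualIsogenyOver_left]
  exact (dualIsogeny_baseChange_eq_lift g ψ D' DB).symm

set_option synthInstance.maxHeartbeats 200000 in
/-- **THE DUAL-POSITION KERNEL COMMUTES WITH BASE CHANGE**: `Ker(ψ^∨) ×_S S′ ≅ Ker((ψ_{S′})^∨)` over `S′`,
compatibly with the inclusions into `B̂ ×_S S′` (★ `GroupSchemeKernel.baseChangeIso` for the right adjoint
`Over.pullback g`, transported along `pullback_map_dualIsogenyOver`). [cite: MumfordAV1970, §15 Thm. 1 (p. 143)]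
[cite: GortzWedhorn2020, Definition 4.45 (2), p. 117] -/
theorem exists_ker_dualIsogenyOver_baseChange_iso :
    ∃ e : (Over.pullback g).obj (ker (dualIsogenyOver ψ D' DB)) ≅
        ker (@dualIsogenyOver S' (A'.baseChange g) (B.baseChange g) (baseChangeHom ψ g)
          (isMonHom_baseChangeHom ψ g) (D'.baseChange g) (DB.baseChange g)),
      e.hom ≫ kerι _ = (Over.pullback g).map (kerι (dualIsogenyOver ψ D' DB)) := by
  haveI := isMonHom_baseChangeHom ψ g
  have hmap := pullback_map_dualIsogenyOver ψ D' DB g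
  -- the two kernels of the equal morphisms `ψ^∨ ×_S S′` and `(ψ_{S′})^∨` are canonically isomorphic
  have h₁ : kerι ((Over.pullback g).map (dualIsogenyOver ψ D' DB)) ≫
      dualIsogenyOver (baseChangeHom ψ g) (D'.baseChange g) (DB.baseChange g) = 1 := by
    rw [← hmap]; exact kerι_comp _
  have h₂ : kerι (dualIsogenyOver (baseChangeHom ψ g) (D'.baseChange g) (DB.baseChange g)) ≫
      (Over.pullback g).map (dualIsogenyOver ψ D' DB) = 1 := by
    rw [hmap]; exact kerι_comp _
  let e₁ : ker ((Over.pullback g).map (dualIsogenyOver ψ D' DB)) ≅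
      ker (dualIsogenyOver (baseChangeHom ψ g) (D'.baseChange g) (DB.baseChange g)) :=
    { hom := kerLift (f := dualIsogenyOver (baseChangeHom ψ g) (D'.baseChange g) (DB.baseChange g)) _ h₁
      inv := kerLift (f := (Over.pullback g).map (dualIsogenyOver ψ D' DB)) _ h₂
      hom_inv_id := ker_hom_ext (by erw [Category.assoc, kerLift_ι, kerLift_ι, Category.id_comp])
      inv_hom_id := ker_hom_ext (by erw [Category.assoc, kerLift_ι, kerLift_ι, Category.id_comp]) }
  refine ⟨GroupSchemeKernel.baseChangeIso g (dualIsogenyOver ψ D' DB) ≪≫ e₁, ?_⟩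
  rw [Iso.trans_hom, Category.assoc]
  erw [kerLift_ι _ h₁]
  exact GroupSchemeKernel.baseChangeIso_hom_comp_kerι g (dualIsogenyOver ψ D' DB)

end BaseChange

/-! ### §4 (ED. 3) `Ker(ψ^∨) → S` is finite ∕ flat when `ψ^∨` is -/

section FiniteFlat

/-- `Ker(ψ^∨) → S` is the second projection of the defining fibre product `Ker(ψ^∨) = B̂ ×_{Â′, ε} S`:
`(pr₂).left = (Ker ψ^∨).hom` (the tensor unit of `Over S` is `𝟙 S`). [cite: GortzWedhorn2020, Definition 4.45 (2), p. 117] -/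
theorem snd_left_eq_ker_hom :
    (pullback.snd (dualIsogenyOver ψ D' DB) η[D'.hat.X]).left = (ker (dualIsogenyOver ψ D' DB)).hom := by
  have h := Over.w (pullback.snd (dualIsogenyOver ψ D' DB) η[D'.hat.X])
  exact (Category.comp_id _).symm.trans h

/-- **`Ker(ψ^∨) → S` IS FINITE when `ψ^∨` is** (base change of `ψ^∨` along the unit section `ε : S → Â′`,
★ `isPullback_kerι_left`). [cite: MumfordAV1970, §15 Thm. 1 (p. 143)] [cite: GortzWedhorn2020, Definition 4.45 (2), p. 117] -/
theorem isFinite_ker_dualIsogenyOver_hom [IsFinite (dualIsogeny ψ D' DB)] :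
    IsFinite (ker (dualIsogenyOver ψ D' DB)).hom := by
  rw [← snd_left_eq_ker_hom]
  have hP := isPullback_kerι_left (dualIsogenyOver ψ D' DB)
  have : IsFinite (dualIsogenyOver ψ D' DB).left := by rw [dualIsogenyOver_left]; infer_instance
  exact MorphismProperty.IsStableUnderBaseChange.of_isPullback hP this

/-- **`Ker(ψ^∨) → S` IS FLAT when `ψ^∨` is.** [cite: MumfordAV1970, §15 Thm. 1 (p. 143)]
[cite: GortzWedhorn2020, Definition 4.45 (2), p. 117] -/
theorem flat_ker_dualIsogenyOver_hom [Flat (dualIsogeny ψ D' DB)] :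
    Flat (ker (dualIsogenyOver ψ D' DB)).hom := by
  rw [← snd_left_eq_ker_hom]
  have hP := isPullback_kerι_left (dualIsogenyOver ψ D' DB)
  have : Flat (dualIsogenyOver ψ D' DB).left := by rw [dualIsogenyOver_left]; infer_instance
  exact MorphismProperty.IsStableUnderBaseChange.of_isPullback hP this

/-- **`Ker(ψ^∨) → S` IS LOCALLY OF FINITE PRESENTATION when `ψ^∨` is** (with finite + flat: `Ker(ψ^∨)` is a finite locally
free `S`-group scheme). [cite: MumfordAV1970, §15 Thm. 1 (p. 143)] [cite: GortzWedhorn2020, Definition 4.45 (2), p. 117] -/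
theorem locallyOfFinitePresentation_ker_dualIsogenyOver_hom [LocallyOfFinitePresentation (dualIsogeny ψ D' DB)] :
    LocallyOfFinitePresentation (ker (dualIsogenyOver ψ D' DB)).hom := by
  rw [← snd_left_eq_ker_hom]
  have hP := isPullback_kerι_left (dualIsogenyOver ψ D' DB)
  have : LocallyOfFinitePresentation (dualIsogenyOver ψ D' DB).left := by rw [dualIsogenyOver_left]; infer_instance
  exact MorphismProperty.IsStableUnderBaseChange.of_isPullback hP this

end FiniteFlat

end DualPair

end AbelianSchemeOver

end Literature.AlgebraicGeometry.AbelianSchemes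

end
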